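import Mathlib
import HarnessLib
import Summits.QuantumFields.YangMills.Theses.PencilRigidity
import Summits.QuantumFields.YangMills.Theorems.PencilRigidityCurvatureKernelBoundCruxToLocalDecay
import Summits.QuantumFields.YangMills.Theorems.PencilRigidityCurvatureKernelBoundTwoPointLocalBoundScaling

/-!
# `CurvatureKernelBound` — the crux forces the smeared lattice bound scale by scale (support for stmt-QuantumFields-11687)

Support file for crux `stmt-QuantumFields-11687` (`PencilRigidity.CurvatureKernelBound`), line
`sixteen-charts-analytic-kernel`, stub `SmearedBoundEventuallyOfCrux` (skeleton v16): it records how far the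
one open lattice stub E^sm (`SmearedLatticeWindowBound`, a `k`-UNIFORM smeared window bound) exceeds the crux.
The crux already forces the smeared lattice bound SCALE BY SCALE: for each fixed pair of real test functions
`f 0, f 1` supported in the closed `ρ`-balls about `∓ s e₀` (`ρ ≤ s/2`, `0 < s < 1`) and each `δ > 0`, the
truncated smeared lattice two-point function `LS₂ k f − LS₁ k (f 0) · LS₁ k (f 1)` is EVENTUALLY (in `k`) at
most `C_T s^(η_T − 10) ((∫|f 0|)(∫|f 1|) + ρ⁸ M₀ M₁) + δ`. So E^sm = crux + `k`-uniformity across the window.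

Route. By the crux, `S₁ 2 F = ∫ K(x₀ − x₁) F` on off-diagonal `F`, with `|K(ξ)| ≤ C (1 + ‖ξ‖^(η−10))` off `0`;
contributing pairs lie on the shell `s ≤ ‖ξ‖ ≤ 3s`, so `‖S₁ 2 F‖ ≤ A (∫|f 0|)(∫|f 1|)` with
`A = max C 0 · (1 + s^(η−10) + (3s)^(η−10)) ≤ max C 0 · (2 + 3^(η−10)) · s^(min η 10 − 10)`
(`CruxToLocalDecayAux`). The translation clause of `W₁` gives `S₁ 1 = κ∫` on real one-point tensors, so the
disconnected part `S₁ 1 F₀ · S₁ 1 F₁` has norm `≤ ‖κ‖² (∫|f 0|)(∫|f 1|) ≤ ‖κ‖² s^(min η 10 − 10) (∫|f 0|)(∫|f 1|)`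
(`s ≤ 1`). The lattice tie of `W₁` at `n = 2, 1` makes the complexified truncated smeared lattice two-point
function converge to `S₁ 2 F − S₁ 1 F₀ · S₁ 1 F₁`, of norm `≤ C_T s^(η_T − 10) (∫|f 0|)(∫|f 1|)` with
`C_T = max C 0 · (2 + 3^(η−10)) + ‖κ‖²`, `η_T = min η 10`, `s₁ = 1`; hence it is eventually within `δ` of
that bound (the slack `ρ⁸ M₀ M₁ ≥ 0` is not needed). [folklore]
-/

noncomputable section

open scoped BigOperators Topology SchwartzMap ComplexConjugate
open MeasureTheory Filter Set Metric
open Literature.MathematicalPhysics.QuantumLattice Literature.MathematicalPhysics.AQFT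
open Literature.MathematicalPhysics.QuantumFieldTheory

namespace Summit.QuantumFields.YangMills.Theorems.CurvatureKernel

namespace SmearedBoundEventuallyAux

/-- The norm of the complexification of `a − b c` is `|a − b c|`. [folklore] -/
theorem norm_ofReal_sub_mul (a b c : ℝ) : ‖(a : ℂ) - (b : ℂ) * (c : ℂ)‖ = |a - b * c| := by
  rw [← Complex.ofReal_mul, ← Complex.ofReal_sub, Complex.norm_real, Real.norm_eq_abs]

/-- **Eventual bound from a limit.** If `u k → L` and `‖L‖ ≤ B`, then for every `δ > 0` eventually
`‖u k‖ ≤ B + δ`. [folklore] -/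
theorem eventually_norm_le_add_of_tendsto {u : ℕ → ℂ} {L : ℂ} {B δ : ℝ} (hu : Tendsto u atTop (𝓝 L))
    (hL : ‖L‖ ≤ B) (hδ : 0 < δ) : ∀ᶠ k in atTop, ‖u k‖ ≤ B + δ := by
  have hlt : ‖L‖ < B + δ := by linarith
  filter_upwards [hu.norm.eventually_lt_const hlt] with k hk
  exact hk.le

/-- **Constant bookkeeping.** From `Z ≤ X + Y`, `X ≤ A P`, `Y ≤ Q P`, `A ≤ A' t`, `Q ≤ Q t` and
`0 ≤ P, 0 ≤ W, 0 ≤ (A' + Q) t`: `Z ≤ (A' + Q) t (P + W)`. [folklore] -/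
theorem le_const_mul_of_parts {Z X Y A A' Q t P W : ℝ} (hZ : Z ≤ X + Y) (hX : X ≤ A * P) (hY : Y ≤ Q * P)
    (hA : A ≤ A' * t) (hQ : Q ≤ Q * t) (hP : 0 ≤ P) (hW : 0 ≤ W) (hC : 0 ≤ (A' + Q) * t) :
    Z ≤ (A' + Q) * t * (P + W) := by
  have h1 : Z ≤ (A + Q) * P := by linarith
  have h2 : (A + Q) * P ≤ (A' + Q) * t * P := by
    have : A + Q ≤ (A' + Q) * t := by linarith
    exact mul_le_mul_of_nonneg_right this hP
  have h3 : (A' + Q) * t * P ≤ (A' + Q) * t * (P + W) :=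
    mul_le_mul_of_nonneg_left (by linarith) hC
  linarith

end SmearedBoundEventuallyAux

open CruxToLocalDecayAux SemiDegenerate BoundedRenormalisation SmearedBoundEventuallyAux in
/-- **`SmearedBoundEventuallyOfCrux`** (stub of line `sixteen-charts-analytic-kernel`, crux
`PencilRigidity.CurvatureKernelBound`, registered signature verbatim): the crux forces the smeared lattice
bound SCALE BY SCALE — for every `W₁`-datum, with `C_T = max C 0 · (2 + 3^(η−10)) + ‖κ‖²`, `η_T = min η 10`,
`s₁ = 1`: for each fixed `s, ρ ≤ s/2, f, M₀, M₁` as in the local two-point bound and each `δ > 0`, eventually in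
`k` the truncated smeared lattice two-point function is at most `C_T s^(η_T−10) ((∫|f 0|)(∫|f 1|) + ρ⁸ M₀ M₁) + δ`
(kernel bound on the shell + `S₁ 1 = κ∫` + the lattice tie at `n = 2, 1`). See the module docstring. [folklore] -/
theorem SmearedBoundEventuallyOfCrux : open Literature.MathematicalPhysics.QuantumLattice Literature.MathematicalPhysics.AQFT Literature.MathematicalPhysics.QuantumFieldTheory in Summit.QuantumFields.YangMills.Theses.PencilRigidity.CurvatureKernelBound → ∀ (G : Type) [Group G] [TopologicalSpace G] [IsTopologicalGroup G] [CompactSpace G] [MeasurableSpace G] [BorelSpace G], IsCompactSimpleLieGroup G → ∀ (r : LatticeRep G) (sch : SpeciesScheme (YMSpecies G)) (S₁ : SchwingerFamily (EuclideanSpace ℝ (Fin 4))), ((∀ (n : ℕ), n ≠ 0 → ∀ (f : Fin n → SchwartzMap (EuclideanSpace ℝ (Fin 4)) ℝ) (F : SchwartzMap (Fin n → (EuclideanSpace ℝ (Fin 4))) ℂ), IsTensorOf F (fun i => ofRealTest (f i)) → IsOffDiagonal F → Filter.Tendsto (fun k : ℕ => ((latticeSchwinger r.ρ sch (fun s =>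 s.F) k n (fun _ => r.curvature) f : ℝ) : ℂ)) Filter.atTop (nhds (S₁ n F))) ∧ (S₁.toLabelled.IsNormalized ∧ S₁.toLabelled.IsHermitian ∧ S₁.toLabelled.HasLinearGrowth ∧ S₁.toLabelled.IsReflectionPositive ∧ S₁.toLabelled.IsSymmetric ∧ S₁.toLabelled.HasClusterProperty) ∧ (∀ (n : ℕ) (a : (EuclideanSpace ℝ (Fin 4))) (F : SchwartzMap (Fin n → (EuclideanSpace ℝ (Fin 4))) ℂ), IsOffDiagonal F → S₁ n (translateMulti a F) = S₁ n F) ∧ (∀ (R : (EuclideanSpace ℝ (Fin 4)) ≃ₗᵢ[ℝ] (EuclideanSpace ℝ (Fin 4))), LinearMap.det (R.toLinearEquiv : (EuclideanSpace ℝ (Fin 4)) →ₗ[ℝ] (EuclideanSpace ℝ (Fin 4))) = 1 → (∀ i : Fin 4, ∃ j : Fin 4, R (EuclideanSpace.single i 1) = EuclideanSpace.single j 1 ∨ R (EuclideanSpace.single i 1) = -EuclideanSpace.single j 1) → ∀ (n : ℕ) (F : SchwartzMap (Fin n → (EuclideanSpace ℝ (Fin 4))) ℂ), IsOffDiagonal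 F → S₁ n (linActMulti R F) = S₁ n F) ∧ (∃ Δ : ℝ, 0 < Δ ∧ S₁.toLabelled.HasMassGap Δ ∧ HasLatticeMassGap r sch Δ)) → ∃ (C η s₁ : ℝ), 0 < η ∧ 0 < s₁ ∧ ∀ (s : ℝ), 0 < s → s < s₁ → ∀ (ρ : ℝ), 0 < ρ → ρ ≤ s / 2 → ∀ (f : Fin 2 → SchwartzMap (EuclideanSpace ℝ (Fin 4)) ℝ) (M₀ M₁ : ℝ), tsupport ((f 0 : SchwartzMap (EuclideanSpace ℝ (Fin 4)) ℝ) : (EuclideanSpace ℝ (Fin 4)) → ℝ) ⊆ Metric.closedBall (EuclideanSpace.single (0 : Fin 4) (-s)) ρ → tsupport ((f 1 : SchwartzMap (EuclideanSpace ℝ (Fin 4)) ℝ) : (EuclideanSpace ℝ (Fin 4)) → ℝ) ⊆ Metric.closedBall (EuclideanSpace.single (0 : Fin 4) s) ρ → (∀ x, |f 0 x| ≤ M₀) → (∀ x, |f 1 x| ≤ M₁) → ∀ (δ : ℝ), 0 < δ → ∀ᶠ k in Filter.atTop, |latticeSchwinger r.ρ sch (fun s => s.F) k 2 (fun _ =>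 r.curvature) f - latticeSchwinger r.ρ sch (fun s => s.F) k 1 (fun _ => r.curvature) (fun _ => f 0) * latticeSchwinger r.ρ sch (fun s => s.F) k 1 (fun _ => r.curvature) (fun _ => f 1)| ≤ C * s ^ (η - 10) * ((∫ x : (EuclideanSpace ℝ (Fin 4)), |f 0 x|) * (∫ x : (EuclideanSpace ℝ (Fin 4)), |f 1 x|) + ρ ^ 8 * M₀ * M₁) + δ := by
  intro hcrux G i1 i2 i3 i4 i5 i6 hG r sch S₁ hW₁
  -- the crux fixes the Borel σ-algebra by `letI := borel G`; ours is (propositionally) the same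
  have hm : i5 = borel G := BorelSpace.measurable_eq
  subst hm
  obtain ⟨K, C, η, hη, -, hbd, hrep⟩ := hcrux G hG r sch S₁ hW₁
  have htie := hW₁.1
  have htr := hW₁.2.2.1
  -- `S₁ 1 = κ∫` on real one-point tensors
  obtain ⟨κ, hκ⟩ := exists_degreeOne_eq_const_mul_realIntegral S₁ htr
  have hC : C ≤ max C 0 := le_max_left _ _
  have hC0 : 0 ≤ max C 0 := le_max_right _ _
  refine ⟨max C 0 * (2 + (3 : ℝ) ^ (η - 10)) + ‖κ‖ ^ 2, min η 10, 1, lt_min hη (by norm_num), one_pos,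
    ?_⟩
  intro s hs hs1 ρ hρ hρs f M₀ M₁ hsupp₀ hsupp₁ hM₀ hM₁ δ hδ
  have hM₀nn : 0 ≤ M₀ := (abs_nonneg _).trans (hM₀ 0)
  have hM₁nn : 0 ≤ M₁ := (abs_nonneg _).trans (hM₁ 0)
  have hI₀ : 0 ≤ ∫ x : EuclideanSpace ℝ (Fin 4), |f 0 x| := integral_nonneg fun _ => abs_nonneg _
  have hI₁ : 0 ≤ ∫ x : EuclideanSpace ℝ (Fin 4), |f 1 x| := integral_nonneg fun _ => abs_nonneg _
  have hPnn : 0 ≤ (∫ x : EuclideanSpace ℝ (Fin 4), |f 0 x|) * (∫ x : EuclideanSpace ℝ (Fin 4), |f 1 x|) :=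
    mul_nonneg hI₀ hI₁
  have hWnn : 0 ≤ ρ ^ 8 * M₀ * M₁ := by positivity
  -- the real tensors `F = f 0 ⊗ f 1`, `F₀ = f 0`, `F₁ = f 1`
  obtain ⟨F, hFt⟩ := exists_isTensorOf (n := 2) (fun i => ofRealTest (f i))
  obtain ⟨F₀, hF₀⟩ := exists_isTensorOf (n := 1) (fun _ : Fin 1 => ofRealTest (f 0))
  obtain ⟨F₁, hF₁⟩ := exists_isTensorOf (n := 1) (fun _ : Fin 1 => ofRealTest (f 1))
  -- the two closed balls are disjoint, so `F` is off-diagonal and the crux's kernel represents `S₁ 2 F`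
  have hdisj : Disjoint (tsupport ((f 0 : 𝓢(EuclideanSpace ℝ (Fin 4), ℝ)) : EuclideanSpace ℝ (Fin 4) → ℝ))
      (tsupport ((f 1 : 𝓢(EuclideanSpace ℝ (Fin 4), ℝ)) : EuclideanSpace ℝ (Fin 4) → ℝ)) :=
    Disjoint.mono hsupp₀ hsupp₁ (disjoint_closedBall_single hs hρs)
  have hFoff : IsOffDiagonal F := isOffDiagonal_of_isTensorOf_of_disjoint hFt hdisj
  obtain ⟨-, hSF⟩ := hrep F hFoff
  -- (1) `|K| ≤ A` on the shell `s ≤ ‖ξ‖ ≤ 3s`, hence `‖S₁ 2 F‖ ≤ A (∫|f 0|)(∫|f 1|)`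
  have hK : ∀ ξ : EuclideanSpace ℝ (Fin 4), s ≤ ‖ξ‖ → ‖ξ‖ ≤ 3 * s →
      |K ξ| ≤ max C 0 * (1 + s ^ (η - 10) + (3 * s) ^ (η - 10)) := by
    intro ξ h1 h2
    have hξ : ξ ≠ 0 := by
      intro h0
      rw [h0, norm_zero] at h1
      linarith
    have hpos : 0 ≤ 1 + ‖ξ‖ ^ (η - 10) := by positivity
    calc |K ξ| ≤ C * (1 + ‖ξ‖ ^ (η - 10)) := hbd ξ hξ
      _ ≤ max C 0 * (1 + ‖ξ‖ ^ (η - 10)) := mul_le_mul_of_nonneg_right hC hpos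
      _ ≤ max C 0 * (1 + s ^ (η - 10) + (3 * s) ^ (η - 10)) := by
          refine mul_le_mul_of_nonneg_left ?_ hC0
          linarith [rpow_shell_le (η := η) hs h1 h2]
  have h2F : ‖S₁ 2 F‖ ≤ max C 0 * (1 + s ^ (η - 10) + (3 * s) ^ (η - 10)) *
      ((∫ x : EuclideanSpace ℝ (Fin 4), |f 0 x|) * (∫ x : EuclideanSpace ℝ (Fin 4), |f 1 x|)) := by
    rw [hSF, ← mul_assoc]
    exact norm_integral_kernel_tensor_le hs hρs hK f hFt hsupp₀ hsupp₁
  -- (2) the disconnected part `S₁ 1 F₀ · S₁ 1 F₁ = κ² (∫ f 0)(∫ f 1)`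
  have hdisc : ‖S₁ 1 F₀ * S₁ 1 F₁‖ ≤
      ‖κ‖ ^ 2 * ((∫ x : EuclideanSpace ℝ (Fin 4), |f 0 x|) * (∫ x : EuclideanSpace ℝ (Fin 4), |f 1 x|)) := by
    rw [hκ (f 0) F₀ hF₀, hκ (f 1) F₁ hF₁]
    exact (norm_disconnected_le κ f).trans_eq (mul_assoc _ _ _)
  -- (3) constants: `A ≤ max C 0 · (2 + 3^(η−10)) · s^(η_T − 10)`, `‖κ‖² ≤ ‖κ‖² · s^(η_T − 10)`
  have hA : max C 0 * (1 + s ^ (η - 10) + (3 * s) ^ (η - 10)) ≤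
      max C 0 * (2 + (3 : ℝ) ^ (η - 10)) * s ^ (min η 10 - 10) := by
    rw [mul_assoc]
    exact mul_le_mul_of_nonneg_left (shell_const_le hs hs1.le) hC0
  have ht1 : (1 : ℝ) ≤ s ^ (min η 10 - 10) :=
    Real.one_le_rpow_of_pos_of_le_one_of_nonpos hs hs1.le (by linarith [min_le_right η 10])
  have hκt : ‖κ‖ ^ 2 ≤ ‖κ‖ ^ 2 * s ^ (min η 10 - 10) := le_mul_of_one_le_right (sq_nonneg _) ht1
  have hCT : 0 ≤ (max C 0 * (2 + (3 : ℝ) ^ (η - 10)) + ‖κ‖ ^ 2) * s ^ (min η 10 - 10) :=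
    mul_nonneg (add_nonneg (mul_nonneg hC0 (by positivity)) (sq_nonneg _)) (Real.rpow_nonneg hs.le _)
  have hlim : ‖S₁ 2 F - S₁ 1 F₀ * S₁ 1 F₁‖ ≤
      (max C 0 * (2 + (3 : ℝ) ^ (η - 10)) + ‖κ‖ ^ 2) * s ^ (min η 10 - 10) *
        ((∫ x : EuclideanSpace ℝ (Fin 4), |f 0 x|) * (∫ x : EuclideanSpace ℝ (Fin 4), |f 1 x|) +
          ρ ^ 8 * M₀ * M₁) :=
    le_const_mul_of_parts (norm_sub_le _ _) h2F hdisc hA hκt hPnn hWnn hCT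
  -- (4) the lattice tie at `n = 2, 1`: the truncated smeared lattice two-point function converges
  have hu := htie 2 two_ne_zero f F hFt hFoff
  have hv := htie 1 one_ne_zero (fun _ => f 0) F₀ hF₀ (HypercubicLimit.Negative.isOffDiagonal_fin_one F₀)
  have hw := htie 1 one_ne_zero (fun _ => f 1) F₁ hF₁ (HypercubicLimit.Negative.isOffDiagonal_fin_one F₁)
  filter_upwards [eventually_norm_le_add_of_tendsto (hu.sub (hv.mul hw)) hlim hδ] with k hk
  rwa [norm_ofReal_sub_mul] at hk

end Summit.QuantumFields.YangMills.Theorems.CurvatureKernel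

end
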